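import Literature.MathematicalPhysics.QuantumLattice.HubbardSpinMomentBounds
import Literature.MathematicalPhysics.QuantumLattice.SpinHalfCasimirBound
import Literature.MathematicalPhysics.QuantumLattice.FermionOperatorsSpinHermitianProofs
import Literature.MathematicalPhysics.QuantumLattice.HubbardModelParticleHoleProofs
import HarnessLib

/-!
# The moment-depletion ceiling on the staggered magnetisation of lattice fermions

Topic `MathematicalPhysics/QuantumLattice` (family `hubbard`). Consequences of the exchange bound
`𝐒_x·𝐒_y ≤ ¼ m_x m_y` (`HubbardSpinMomentBounds`) for two-spin-state fermions on a finite ordered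
site set `Λ` (`m_x = n_{x↑} + n_{x↓} - 2 n_{x↑}n_{x↓}` the local moment / single-occupancy projector):

* **Casimir bound through local moments**: for a finite set of sites `Y`,
  `Σ_{x,y∈Y} 𝐒_x·𝐒_y ≤ ((|Y|+2)/4) Σ_{x∈Y} m_x` — the operator form of "the total spin `S_Y` of the
  electrons in `Y` obeys `S_Y(S_Y+1) ≤ (M_Y/2)(M_Y/2+1)` with `M_Y` the number of singly occupied
  sites, and `M_Y ≤ |Y|`" (addition of angular momenta, Tasaki (2020) App. A.3; Lieb (1989));
* `S² = Σ_{x,y} 𝐒_x·𝐒_y ⪰ 0`;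
* for a bipartition `Λ = A ⊔ Aᶜ` with `|A|, |Aᶜ| ≤ k`, the **staggered spin structure operator**
  `𝓢_A = Σ_{x,y} ε_x ε_y 𝐒_x·𝐒_y` (`ε = +1` on `A`, `-1` off `A`) equals `2 𝐒_A² + 2 𝐒_{Aᶜ}² - S²` and
  therefore satisfies the operator inequality (the **moment-depletion ceiling**)
  `𝓢_A ≤ ((k+2)/2) Σ_x m_x = ((k+2)/2) (N̂ - 2 D̂)`, `D̂ = Σ_x n_{x↑} n_{x↓}`;
* in an `N`-particle unit vector `ψ`: `Re ⟨ψ, 𝓢_A ψ⟩ ≤ ((k+2)/2) (N - 2 Re ⟨ψ, D̂ ψ⟩)` — a certified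
  LOWER bracket on the double occupancy is a certified UPPER bracket on the staggered magnetisation
  `m_s² = ⟨𝓢_A⟩/|Λ|²`, with no solver (at half filling on a bipartite `|A| = |Aᶜ| = |Λ|/2` lattice:
  `m_s² ≤ (¼ + 1/|Λ|)(1 - 2d)`, `d = ⟨D̂⟩/|Λ|`; at `d = 0` this is the Heisenberg Casimir ceiling
  `¼ + 1/|Λ|`).

Everything is a proved theorem; no named fact. Main declarations (namespace `FermionSpinMoment`):
`posSemidef_momentCasimir_sub`, `posSemidef_sum_sum_fermionSpinDot` (`S² ⪰ 0`), `stagSign`, `stagSpinStructure`,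
`stagSpinStructure_eq`, `localMoment_eq_sq` (`m_x = (n_{x↑} - n_{x↓})²`), `sum_localMoment_eq`,
`posSemidef_stagCeiling_sub`, `re_expect_stagSpinStructure_le`.

## References
* J. E. Hirsch, Phys. Rev. B 31 (1985) 4403, Table II (`⟨σ_z²⟩`, the local moment).
  [cite: HirschPRB1985, Table II]
* H. Tasaki, *Physics and Mathematics of Quantum Many-Body Systems*, Springer (2020), §2.4 and
  App. A.3 (addition of spins; `S_tot ≤ n/2` for `n` spins ½), §9.3 (spin operators of electrons).
  [cite: Tasaki2020, App. A.3]
* E. H. Lieb, *Two theorems on the Hubbard model*, Phys. Rev. Lett. 62 (1989) 1201 (total spin of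
  Hubbard ground states on bipartite lattices, `2S = |B| - |A|`). [cite: LiebPRL1989, Thm. 2]
* A. Altland, B. Simons, *Condensed Matter Field Theory*, 2nd ed. (2010), §2.2 (exchange identity on
  the singly occupied subspace). [cite: AltlandSimons2010, §2.2 (exchange interaction)]
-/

noncomputable section

namespace Literature.MathematicalPhysics.QuantumLattice

open Matrix Finset HubbardWave0 Literature.Probability.LatticeModels
open scoped ComplexOrder

namespace FermionSpinMoment

variable {Λ : Type*} [LinearOrder Λ] [Fintype Λ]

/-- `0 ≤ 1/4` in the star order of `ℂ` (private arithmetic helper). [folklore] -/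
private theorem quarter_nonneg : (0 : ℂ) ≤ 1 / 4 := by
  rw [show (1 / 4 : ℂ) = ((1 / 4 : ℝ) : ℂ) by norm_num]
  exact Complex.zero_le_real.2 (by norm_num)

/-- `0 ≤ 2` in the star order of `ℂ` (private arithmetic helper). [folklore] -/
private theorem two_nonneg : (0 : ℂ) ≤ 2 := by
  rw [show (2 : ℂ) = ((2 : ℝ) : ℂ) by norm_num]
  exact Complex.zero_le_real.2 (by norm_num)

/-! ### The Casimir bound through local moments -/

/-- **Casimir bound through local moments**: `((|Y|+2)/4) Σ_{x∈Y} m_x - Σ_{x,y∈Y} 𝐒_x·𝐒_y`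
`= Σ_{x≠y∈Y} [(¼ m_x m_y - 𝐒_x·𝐒_y) + ¼ (m_x - m_x m_y)] ⪰ 0` — the total spin of the electrons in `Y`
is at most half the number of singly occupied sites of `Y`. [cite: Tasaki2020, App. A.3] -/
theorem posSemidef_momentCasimir_sub (Y : Finset Λ) :
    (((((Y.card : ℂ) + 2) / 4) • ∑ x ∈ Y, localMoment x) - ∑ x ∈ Y, ∑ y ∈ Y, fermionSpinDot x y).PosSemidef := by
  have hsplit : ∀ x ∈ Y, ∑ y ∈ Y, fermionSpinDot x y =
      (3 / 4 : ℂ) • localMoment x + ∑ y ∈ Y.erase x, fermionSpinDot x y := by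
    intro x hx
    rw [← Finset.add_sum_erase Y _ hx, fermionSpinDot_self]
  have hcoef : ∀ x ∈ Y, (((Y.card : ℂ) + 2) / 4) • localMoment x =
      (3 / 4 : ℂ) • localMoment x + ∑ _y ∈ Y.erase x, (1 / 4 : ℂ) • localMoment x := by
    intro x hx
    rw [Finset.sum_const, Finset.card_erase_of_mem hx, ← Nat.cast_smul_eq_nsmul ℂ, smul_smul, ← add_smul,
      Nat.cast_sub (Nat.succ_le_of_lt (Finset.card_pos.2 ⟨x, hx⟩)), Nat.cast_one]
    congr 1
    ring
  have key : ((((Y.card : ℂ) + 2) / 4) • ∑ x ∈ Y, localMoment x) - ∑ x ∈ Y, ∑ y ∈ Y, fermionSpinDot x y =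
      ∑ x ∈ Y, ∑ y ∈ Y.erase x, (((1 / 4 : ℂ) • (localMoment x * localMoment y) - fermionSpinDot x y) +
        (1 / 4 : ℂ) • (localMoment x - localMoment x * localMoment y)) := by
    rw [Finset.smul_sum, ← Finset.sum_sub_distrib]
    refine Finset.sum_congr rfl fun x hx => ?_
    rw [hsplit x hx, hcoef x hx, add_sub_add_left_eq_sub, ← Finset.sum_sub_distrib]
    refine Finset.sum_congr rfl fun y _ => ?_
    module
  rw [key]
  refine posSemidef_finset_sum _ fun x _ => posSemidef_finset_sum _ fun y hy => ?_
  exact (posSemidef_quarter_localMoment_mul_sub_fermionSpinDot (Finset.ne_of_mem_erase hy).symm).add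
    ((posSemidef_localMoment_sub_mul x y).smul quarter_nonneg)

/-- `Σ_{x∈Y} m_x ⪰ 0`. [cite: EsslerEtAl2005, §2.2.5 eq. (2.76)] -/
theorem posSemidef_sum_localMoment (Y : Finset Λ) : (∑ x ∈ Y, localMoment x).PosSemidef :=
  posSemidef_finset_sum _ fun x _ => posSemidef_localMoment x

/-- `Σ_{x,y} 𝐒_x·𝐒_y = S² = (S^z)² + ½ (S⁺(S⁺)† + (S⁺)†S⁺) ⪰ 0`. [cite: LiebPRL1989, Thm. 2] -/
theorem posSemidef_sum_sum_fermionSpinDot :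
    (∑ x : Λ, ∑ y : Λ, fermionSpinDot x y : Matrix (Finset (Orb Λ)) (Finset (Orb Λ)) ℂ).PosSemidef := by
  have hhalf : (0 : ℂ) ≤ 1 / 2 := by
    rw [show (1 / 2 : ℂ) = ((1 / 2 : ℝ) : ℂ) by norm_num]
    exact Complex.zero_le_real.2 (by norm_num)
  have hz : (HubbardWave0.spinZ * HubbardWave0.spinZ : Matrix (Finset (Orb Λ)) (Finset (Orb Λ)) ℂ) =
      HubbardWave0.spinZᴴ * HubbardWave0.spinZ := by rw [HubbardWave0.spinZ_isHermitian.eq]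
  have hp : (spinPlus * spinPlusᴴ : Matrix (Finset (Orb Λ)) (Finset (Orb Λ)) ℂ) = (spinPlusᴴ)ᴴ * spinPlusᴴ := by
    rw [conjTranspose_conjTranspose]
  rw [sum_sum_fermionSpinDot, spinSq, hz, hp]
  exact (posSemidef_conjTranspose_mul_self _).add
    (((posSemidef_conjTranspose_mul_self _).add (posSemidef_conjTranspose_mul_self _)).smul hhalf)

/-! ### The staggered spin structure operator and its ceiling -/

/-- The sign `ε_x = +1` on `A`, `-1` off `A`. [cite: LiebPRL1989, Thm. 2] -/
def stagSign (A : Finset Λ) (x : Λ) : ℂ := if x ∈ A then 1 else -1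

omit [Fintype Λ] in
/-- `ε_x = 1` for `x ∈ A`. [cite: LiebPRL1989, Thm. 2] -/
theorem stagSign_of_mem {A : Finset Λ} {x : Λ} (hx : x ∈ A) : stagSign A x = 1 := if_pos hx

/-- `ε_x = -1` for `x ∈ Aᶜ`. [cite: LiebPRL1989, Thm. 2] -/
theorem stagSign_of_mem_compl {A : Finset Λ} {x : Λ} (hx : x ∈ Aᶜ) : stagSign A x = -1 :=
  if_neg (Finset.mem_compl.1 hx)

/-- **The staggered spin structure operator** `𝓢_A = Σ_{x,y} ε_x ε_y 𝐒_x·𝐒_y` of a bipartition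
`Λ = A ⊔ Aᶜ` (`|Λ|²` times the squared staggered magnetisation `m_s²`). [cite: LiebPRL1989, Thm. 2] -/
def stagSpinStructure (A : Finset Λ) : Matrix (Finset (Orb Λ)) (Finset (Orb Λ)) ℂ :=
  ∑ x, ∑ y, (stagSign A x * stagSign A y) • fermionSpinDot x y

/-- `𝓢_A = 2 𝐒_A² + 2 𝐒_{Aᶜ}² - S²` (`𝐒_Y² = Σ_{x,y∈Y} 𝐒_x·𝐒_y`, `S² = Σ_{x,y} 𝐒_x·𝐒_y`).
[cite: LiebPRL1989, Thm. 2] -/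
theorem stagSpinStructure_eq (A : Finset Λ) :
    stagSpinStructure A = (2 : ℂ) • (∑ x ∈ A, ∑ y ∈ A, fermionSpinDot x y) +
      (2 : ℂ) • (∑ x ∈ Aᶜ, ∑ y ∈ Aᶜ, fermionSpinDot x y) - ∑ x, ∑ y, fermionSpinDot x y := by
  have hin : ∀ x, ∑ y, (stagSign A x * stagSign A y) • fermionSpinDot x y =
      stagSign A x • (∑ y ∈ A, fermionSpinDot x y - ∑ y ∈ Aᶜ, fermionSpinDot x y) := by
    intro x
    rw [← Finset.sum_add_sum_compl A, smul_sub, Finset.smul_sum, Finset.smul_sum, sub_eq_add_neg,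
      ← Finset.sum_neg_distrib]
    congr 1
    · exact Finset.sum_congr rfl fun y hy => by rw [stagSign_of_mem hy, mul_one]
    · exact Finset.sum_congr rfl fun y hy => by rw [stagSign_of_mem_compl hy, mul_neg_one, neg_smul]
  have hall : ∑ x, ∑ y, fermionSpinDot x y = (∑ x ∈ A, ∑ y ∈ A, fermionSpinDot x y +
      ∑ x ∈ A, ∑ y ∈ Aᶜ, fermionSpinDot x y) + (∑ x ∈ Aᶜ, ∑ y ∈ A, fermionSpinDot x y +
      ∑ x ∈ Aᶜ, ∑ y ∈ Aᶜ, fermionSpinDot x y) := by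
    rw [← Finset.sum_add_sum_compl A, ← Finset.sum_add_distrib, ← Finset.sum_add_distrib]
    congr 1 <;> exact Finset.sum_congr rfl fun x _ => (Finset.sum_add_sum_compl A _).symm
  rw [stagSpinStructure, Finset.sum_congr rfl fun x _ => hin x, ← Finset.sum_add_sum_compl A, hall]
  have hA : ∑ x ∈ A, stagSign A x • (∑ y ∈ A, fermionSpinDot x y - ∑ y ∈ Aᶜ, fermionSpinDot x y) =
      ∑ x ∈ A, ∑ y ∈ A, fermionSpinDot x y - ∑ x ∈ A, ∑ y ∈ Aᶜ, fermionSpinDot x y := by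
    rw [← Finset.sum_sub_distrib]
    exact Finset.sum_congr rfl fun x hx => by rw [stagSign_of_mem hx, one_smul]
  have hAc : ∑ x ∈ Aᶜ, stagSign A x • (∑ y ∈ A, fermionSpinDot x y - ∑ y ∈ Aᶜ, fermionSpinDot x y) =
      ∑ x ∈ Aᶜ, ∑ y ∈ Aᶜ, fermionSpinDot x y - ∑ x ∈ Aᶜ, ∑ y ∈ A, fermionSpinDot x y := by
    rw [← Finset.sum_sub_distrib]
    exact Finset.sum_congr rfl fun x hx => by rw [stagSign_of_mem_compl hx, neg_one_smul, neg_sub]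
  rw [hA, hAc]
  module

/-- `m_x = (n_{x↑} - n_{x↓})²`: the local moment is the square of Hirsch's `σ_z = n_↑ - n_↓`
(so `⟨m_x⟩` is the `⟨σ_z²⟩` of Hirsch's Table II). [cite: HirschPRB1985, Table II] -/
theorem localMoment_eq_sq (x : Λ) :
    localMoment x = (numberOp x 0 - numberOp x 1) * (numberOp x 0 - numberOp x 1) := by
  rw [localMoment_eq_diagonal, LiebThm1.numberOp_eq_diagonal, LiebThm1.numberOp_eq_diagonal, diagonal_sub,
    diagonal_mul_diagonal]
  congr 1
  funext s
  simp only [localMomentFun]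
  split_ifs <;> norm_num

/-- `Σ_x m_x = N̂ - 2 D̂` (`D̂ = Σ_x n_{x↑}n_{x↓}`): singly occupied sites = particles − 2·doublons.
[cite: EsslerEtAl2005, §2.2.5 eq. (2.76)] -/
theorem sum_localMoment_eq :
    ∑ x : Λ, localMoment x = totalNumber - (2 : ℂ) • ∑ x : Λ, numberOp x 0 * numberOp x 1 := by
  rw [totalNumber, Finset.smul_sum, ← Finset.sum_sub_distrib]
  exact Finset.sum_congr rfl fun x _ => by rw [localMoment, Fin.sum_univ_two]

/-- **The moment-depletion ceiling** (operator form): for a bipartition with `|A|, |Aᶜ| ≤ k`,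
`((k+2)/2) Σ_x m_x - 𝓢_A = 2[((|A|+2)/4) M_A - 𝐒_A²] + 2[((|Aᶜ|+2)/4) M_{Aᶜ} - 𝐒_{Aᶜ}²]`
`+ ((k-|A|)/2) M_A + ((k-|Aᶜ|)/2) M_{Aᶜ} + S² ⪰ 0`. [cite: Tasaki2020, App. A.3] -/
theorem posSemidef_stagCeiling_sub (A : Finset Λ) {k : ℕ} (hA : A.card ≤ k) (hAc : Aᶜ.card ≤ k) :
    (((((k : ℂ) + 2) / 2) • ∑ x : Λ, localMoment x) - stagSpinStructure A).PosSemidef := by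
  have hcast : ∀ {m : ℕ}, m ≤ k → (0 : ℂ) ≤ ((k : ℂ) - m) / 2 := by
    intro m hm
    rw [show ((k : ℂ) - m) / 2 = ((((k : ℝ) - m) / 2 : ℝ) : ℂ) by push_cast; ring]
    have : (m : ℝ) ≤ k := by exact_mod_cast hm
    exact Complex.zero_le_real.2 (by linarith)
  have key : ((((k : ℂ) + 2) / 2) • ∑ x : Λ, localMoment x) - stagSpinStructure A =
      (2 : ℂ) • (((((A.card : ℂ) + 2) / 4) • ∑ x ∈ A, localMoment x) - ∑ x ∈ A, ∑ y ∈ A, fermionSpinDot x y) +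
      (2 : ℂ) • (((((Aᶜ.card : ℂ) + 2) / 4) • ∑ x ∈ Aᶜ, localMoment x) - ∑ x ∈ Aᶜ, ∑ y ∈ Aᶜ, fermionSpinDot x y) +
      ((((k : ℂ) - A.card) / 2) • ∑ x ∈ A, localMoment x + (((k : ℂ) - Aᶜ.card) / 2) • ∑ x ∈ Aᶜ, localMoment x) +
      ∑ x, ∑ y, fermionSpinDot x y := by
    rw [stagSpinStructure_eq, ← Finset.sum_add_sum_compl A (fun x => localMoment x)]
    module
  rw [key]
  refine (((((posSemidef_momentCasimir_sub A).smul two_nonneg).add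
    ((posSemidef_momentCasimir_sub Aᶜ).smul two_nonneg)).add
    (((posSemidef_sum_localMoment A).smul (hcast hA)).add ((posSemidef_sum_localMoment Aᶜ).smul (hcast hAc)))).add ?_)
  exact posSemidef_sum_sum_fermionSpinDot

/-- **The moment-depletion ceiling** (expectation form): in an `N`-particle unit vector `ψ`,
`Re ⟨ψ, 𝓢_A ψ⟩ ≤ ((k+2)/2) · (N - 2 Re ⟨ψ, D̂ ψ⟩)` whenever `|A|, |Aᶜ| ≤ k`. [cite: Tasaki2020, App. A.3] -/
theorem re_expect_stagSpinStructure_le (A : Finset Λ) {k : ℕ} (hA : A.card ≤ k) (hAc : Aᶜ.card ≤ k)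
    {N : ℕ} {ψ : Fock (Orb Λ)} (hN : IsNParticle N ψ) (hψ1 : star ψ ⬝ᵥ ψ = 1) :
    (star ψ ⬝ᵥ (stagSpinStructure A *ᵥ ψ)).re ≤
      (((k : ℝ) + 2) / 2) * (N - 2 * (star ψ ⬝ᵥ ((∑ x : Λ, numberOp x 0 * numberOp x 1) *ᵥ ψ)).re) := by
  have h := (posSemidef_stagCeiling_sub A hA hAc).dotProduct_mulVec_nonneg ψ
  rw [sum_localMoment_eq, sub_mulVec, smul_mulVec, sub_mulVec, smul_mulVec,
    totalNumber_mulVec_of_isNParticle hN, dotProduct_sub, dotProduct_smul, dotProduct_sub, dotProduct_smul,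
    dotProduct_smul, hψ1] at h
  have hc : (((k : ℂ) + 2) / 2) = ((((k : ℝ) + 2) / 2 : ℝ) : ℂ) := by push_cast; ring
  rw [hc] at h
  obtain ⟨hre, -⟩ := Complex.nonneg_iff.mp h
  simp only [Complex.sub_re, smul_eq_mul, mul_one, Complex.natCast_re, Complex.mul_re, Complex.ofReal_re,
    Complex.ofReal_im, Complex.re_ofNat, Complex.im_ofNat, zero_mul, sub_zero] at hre
  linarith

end FermionSpinMoment

end Literature.MathematicalPhysics.QuantumLattice
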